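import Literature.Geometry.Riemannian.MeanConvexSurroundingOuterBand
import Literature.Topology.FourManifolds.MorseLemma
import Literature.Topology.FourManifolds.GradientLikeDynamics

/-!
# Preliminaries for the mean-convex sweep (Lawson–Michelsohn 1984, Thm. 6.1): the ambient
# Morse function normalised off the domain, and Euclidean Morse charts at a critical level

Topic `Geometry/Riemannian` (fact seat
`provefact-Literature.Geometry.Riemannian.LawsonMichelsohn1984_surrounding`).  Everything here
is **proved**; no named fact is introduced.

Lawson–Michelsohn, *Embedding and surrounding with positive mean curvature* (1984), prove
Thm. 6.1 by sweeping the handle decomposition of the `1`-thin domain `D ⊂ ℝ^{m+1}` given by a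
Morse function `f` on `(D; ∅, ∂D)` without handles of index `≥ m`: *"`D_f` can be built from a
small ball by attaching thin handles of index `≤ n - 2`, and Theorem 3.1 applies at each
stage"*.  In the tree the sweep is run on `ℝ^{m+1}` itself, on the Seeley extension `f̂` of `f`
(`IsRegularCompactDomain.exists_contDiff_forall_eq`), critical level by critical level (Milnor,
*Morse theory* (1963), Thms. 3.1, 3.2).  This file provides the two soft preliminaries:

* `IsRegularCompactDomain.exists_normalised_clock` — **normalisation off the domain**: a smooth
  `g` with `g = 1` on `∂D = {F = 0}`, `g < 1` on `{F < 0}` and `dg ≠ 0` on `∂D` agrees on an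
  open neighbourhood of `D` with a smooth `ĝ` which is `> 1` off `D` (`ĝ ≤ 1 ↔ F ≤ 0`,
  `ĝ = 1 ↔ F = 0`) and `= 2` off a compact set (push `∂D` outward along the gradient collar of
  `F`, where `dg` is a positive multiple of `dF` — `exists_pos_fderiv_eq_smul` — and cut off);
  so all sublevel sets `{ĝ ≤ s}`, `s < 2`, are compact and those with `s ≤ 1` lie in `D`.
* `exists_morseCharts_finset` — **disjoint Euclidean Morse charts at finitely many
  nondegenerate critical points of one level**: charts `e_p` of the `C^∞` maximal atlas of
  `ℝ^{m+1}` centred at the points `p` of a finite set `P` (`e_p p = 0`), with a common closed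
  ball `B̄(0, R)` in their targets, Milnor's normal form `f ∘ e_p⁻¹ = c - ξ + η` on the targets
  (index `λ_p` = the negative index of inertia of `D²f(p)`), pairwise disjoint closed chart balls
  inside a prescribed open set (the Morse lemma of the tree,
  `exists_openPartialHomeomorph_comp_symm_eq_sum_sq`, Hirsch 1976, Ch. 6, Thm. 1.1, translated
  to `p` and shrunk) — the chart data consumed by `exists_thinHandleFunction`
  (`ThinHandleFunction.lean`).
* `exists_morseCharts_transport` — the same data transported by a diffeomorphism `Φ` of
  `ℝ^{m+1}`: `e_p ∘ Φ⁻¹` are Morse charts for `f ∘ Φ⁻¹` at `Φ p`.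

## References

* H. B. Lawson, Jr., M.-L. Michelsohn, *Embedding and surrounding with positive mean curvature*,
  Invent. Math. 77 (1984) 399–419, Thms. 3.1, 6.1. [LawsonMichelsohn1984]
* J. Milnor, *Morse theory*, Ann. of Math. Studies 51 (1963), §2 (Lemma 2.2), Thms. 3.1, 3.2.
  [Milnor1963]
* M. W. Hirsch, *Differential Topology* (1976), Ch. 6 §1, Thm. 1.1. [HirschDT1976]
-/

noncomputable section

open scoped Manifold ContDiff Topology
open Set Function Filter Metric Literature.Topology.FourManifolds

namespace Literature.Geometry.Riemannian

variable {E : Type*} [NormedAddCommGroup E] [InnerProductSpace ℝ E] [FiniteDimensional ℝ E]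

/-! ### Normalisation of the clock off the domain -/

/-- A continuous function positive on a compact set is bounded below there by a positive
constant. [folklore] -/
theorem exists_pos_lowerBound_of_isCompact {X : Type*} [TopologicalSpace X] {ψ : X → ℝ}
    (hψ : Continuous ψ) {K : Set X} (hK : IsCompact K) (hpos : ∀ x ∈ K, 0 < ψ x) :
    ∃ κ, 0 < κ ∧ ∀ x ∈ K, κ ≤ ψ x := by
  rcases K.eq_empty_or_nonempty with h | h
  · exact ⟨1, one_pos, fun x hx => by rw [h] at hx; exact hx.elim⟩
  · obtain ⟨x₀, hx₀, hmin⟩ := hK.exists_isMinOn h hψ.continuousOn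
    exact ⟨ψ x₀, hpos x₀ hx₀, fun x hx => hmin hx⟩

/-- **Normalisation of a clock off a compact regular domain.**  Let `D = {F ≤ 0}` be compact
with `dF ≠ 0` on `{F = 0}`, and let `g` be `C^∞` with `g = 1` on `{F = 0}`, `g < 1` on `{F < 0}`
and `dg ≠ 0` on `{F = 0}`.  Then there is a `C^∞` function `ĝ` equal to `g` on an open
neighbourhood of `D`, equal to `2` off a compact set, with `ĝ ≤ 1 ↔ F ≤ 0` and
`ĝ = 1 ↔ F = 0`; in particular every sublevel set `{ĝ ≤ s}` with `s < 2` is compact.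
(Along the gradient collar of `F` the function `g` increases through `∂D` at positive speed,
`dg = λ dF` with `λ > 0` by `exists_pos_fderiv_eq_smul`, so `g > 1` on a thin outer collar; cut
off outside.) [folklore] -/
theorem exists_normalised_clock {F g : E → ℝ} (hF : ContDiff ℝ ∞ F)
    (hD : IsCompact {x | F x ≤ 0}) (hreg : ∀ x, F x = 0 → fderiv ℝ F x ≠ 0)
    (hg : ContDiff ℝ ∞ g) (hg1 : ∀ x, F x = 0 → g x = 1)
    (hglt : ∀ x, F x < 0 → g x < 1) (hgreg : ∀ x, F x = 0 → fderiv ℝ g x ≠ 0) :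
    ∃ ĝ : E → ℝ, ContDiff ℝ ∞ ĝ ∧
      (∃ U : Set E, IsOpen U ∧ {x | F x ≤ 0} ⊆ U ∧ ∀ x ∈ U, ĝ x = g x) ∧
      (∃ S : Set E, IsCompact S ∧ ∀ x ∉ S, ĝ x = 2) ∧
      (∀ x, ĝ x ≤ 1 ↔ F x ≤ 0) ∧ (∀ x, ĝ x = 1 ↔ F x = 0) ∧
      (∀ s, s < 2 → IsCompact {x | ĝ x ≤ s}) := by
  have hgle : ∀ x, F x ≤ 0 → g x ≤ 1 := fun x hx => by
    rcases hx.lt_or_eq with h | h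
    · exact (hglt x h).le
    · exact (hg1 x h).le
  obtain ⟨η₀, θ, O, hη₀, hθc, hθ0, hadd, -, -, -, hOo, hZO, -, hclock, -, htrackO, -, -⟩ :=
    exists_gradientCollarFlow hF hD hreg
  have hFd : Differentiable ℝ F := hF.differentiable (by simp)
  have hgd : Differentiable ℝ g := hg.differentiable (by simp)
  set Θ : E × ℝ → E := fun p => θ p.1 p.2 with hΘ
  have hΘd : Differentiable ℝ Θ := hθc.differentiable (by simp)
  -- the velocity field of the flow
  set V : E → E := fun z => fderiv ℝ Θ (z, 0) (0, 1) with hV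
  have hVc : Continuous V := by
    have h1 : Continuous fun z : E => fderiv ℝ Θ (z, 0) :=
      (hθc.continuous_fderiv (by simp)).comp (continuous_id.prodMk continuous_const)
    exact h1.clm_apply continuous_const
  -- `∂ₛ θ (z, s) = V (θ z s)` (group law)
  have hderiv : ∀ z s, HasDerivAt (fun t => θ z t) (V (θ z s)) s := by
    intro z s
    have hprod : HasDerivAt (fun t : ℝ => (θ z s, t)) ((0 : E), (1 : ℝ)) (s - s) :=
      (hasDerivAt_const (s - s) (θ z s)).prodMk (hasDerivAt_id (s - s))
    have h1 : HasDerivAt (fun t : ℝ => Θ (θ z s, t)) (V (θ z s)) (s - s) := by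
      have h := (hΘd (θ z s, s - s)).hasFDerivAt.comp_hasDerivAt (s - s) hprod
      rw [sub_self] at h ⊢
      exact h
    have hsub : HasDerivAt (fun t : ℝ => t - s) 1 s := (hasDerivAt_id s).sub_const s
    have h2 := HasDerivAt.scomp (h := fun t : ℝ => t - s) s h1 hsub
    rw [one_smul] at h2
    have heq : ((fun t : ℝ => Θ (θ z s, t)) ∘ fun t => t - s) = fun t => θ z t := by
      funext t
      show θ (θ z s) (t - s) = θ z t
      rw [← hadd, add_sub_cancel]
    rwa [heq] at h2
  -- `dF(V) = 1` on `O`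
  have hdFV : ∀ z ∈ O, fderiv ℝ F z (V z) = 1 := by
    intro z hz
    have hI : Ioo (-(4 * η₀)) (4 * η₀) ∈ 𝓝 (0 : ℝ) :=
      isOpen_Ioo.mem_nhds ⟨by linarith, by linarith⟩
    have hcomp : HasDerivAt (fun s => F (θ z s)) (fderiv ℝ F z (V z)) 0 := by
      have h := (hFd (θ z 0)).hasFDerivAt.comp_hasDerivAt (0 : ℝ) (hderiv z 0)
      rwa [hθ0] at h
    have hid : HasDerivAt (fun s => F (θ z s)) 1 0 := by
      have h' : HasDerivAt (fun s : ℝ => F z + s) 1 0 := (hasDerivAt_id (0 : ℝ)).const_add (F z)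
      refine h'.congr_of_eventuallyEq ?_
      filter_upwards [hI] with s hs
      exact hclock z hz s (Ioo_subset_Icc_self hs)
    exact hcomp.unique hid
  -- `ψ = dg(V)` is continuous and positive on `{F = 0}`
  set ψ : E → ℝ := fun z => fderiv ℝ g z (V z) with hψ
  have hψc : Continuous ψ :=
    (hg.continuous_fderiv (by simp)).clm_apply hVc
  have hψpos : ∀ x, F x = 0 → 0 < ψ x := by
    intro x hx
    obtain ⟨c, hc, hcx⟩ := exists_pos_fderiv_eq_smul hF hD hreg hg hg1 hgle hgreg hx
    show 0 < fderiv ℝ g x (V x)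
    rw [hcx, smul_apply, hdFV x (hZO hx), smul_eq_mul, mul_one]
    exact hc
  have hZc : IsCompact {x : E | F x = 0} :=
    hD.of_isClosed_subset (isClosed_eq hF.continuous continuous_const) fun x hx => le_of_eq hx
  obtain ⟨κ2, hκ2, hκ2Z⟩ := exists_pos_lowerBound_of_isCompact hψc hZc fun z hz => hψpos z hz
  set κ : ℝ := κ2 / 2 with hκ
  have hκpos : 0 < κ := by positivity
  -- the open set where `ψ > κ`, and a uniform time `ε` keeping `Z`-tracks inside it
  set U : Set E := {z | κ < ψ z} ∩ O with hU
  have hUo : IsOpen U := (isOpen_lt continuous_const hψc).inter hOo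
  have hZU : ∀ x, F x = 0 → x ∈ U := fun x hx =>
    ⟨by show κ < ψ x; have := hκ2Z x hx; rw [hκ]; linarith, hZO hx⟩
  have hev : ∀ᶠ s in 𝓝 (0 : ℝ), ∀ x ∈ {x : E | F x = 0}, θ x s ∈ U := by
    refine hZc.eventually_forall_of_forall_eventually fun x hx => ?_
    have hcont : Continuous fun q : ℝ × E => θ q.2 q.1 :=
      hθc.continuous.comp (continuous_snd.prodMk continuous_fst)
    have : (fun q : ℝ × E => θ q.2 q.1) ⁻¹' U ∈ 𝓝 ((0 : ℝ), x) := by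
      refine hcont.continuousAt.preimage_mem_nhds ?_
      show U ∈ 𝓝 (θ x 0)
      rw [hθ0]; exact hUo.mem_nhds (hZU x hx)
    exact this
  obtain ⟨ε₁, hε₁, hε₁U⟩ : ∃ ε₁ > (0 : ℝ), ∀ s, |s| < ε₁ → ∀ x, F x = 0 → θ x s ∈ U := by
    obtain ⟨r, hr, hrU⟩ := Metric.mem_nhds_iff.1 hev
    exact ⟨r, hr, fun s hs x hx => hrU (by simpa [Real.dist_eq] using hs) x hx⟩
  set ε : ℝ := min (ε₁ / 2) η₀ with hε
  have hεpos : 0 < ε := lt_min (by positivity) hη₀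
  have hεε₁ : ε < ε₁ := (min_le_left _ _).trans_lt (by linarith)
  have hεη : ε ≤ η₀ := min_le_right _ _
  have htrackU : ∀ x, F x = 0 → ∀ s ∈ Icc (-ε) ε, θ x s ∈ U := fun x hx s hs =>
    hε₁U s (abs_lt.2 ⟨by linarith [hs.1], by linarith [hs.2]⟩) x hx
  -- outward estimate: `g (θ x s) ≥ 1 + κ s` for `F x = 0`, `0 ≤ s ≤ ε`
  have hout : ∀ x, F x = 0 → ∀ s ∈ Icc 0 ε, 1 + κ * s ≤ g (θ x s) := by
    intro x hx s hs
    have hd : ∀ t, HasDerivAt (fun u => g (θ x u)) (ψ (θ x t)) t := fun t =>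
      (hgd (θ x t)).hasFDerivAt.comp_hasDerivAt t (hderiv x t)
    have key := (convex_Icc (0 : ℝ) ε).mul_sub_le_image_sub_of_le_deriv
      (f := fun u => g (θ x u)) (fun t _ => (hd t).continuousAt.continuousWithinAt)
      (fun t _ => (hd t).differentiableAt.differentiableWithinAt) (C := κ)
      (fun t ht => by
        rw [interior_Icc] at ht
        rw [(hd t).deriv]
        exact (htrackU x hx t ⟨by linarith [ht.1], ht.2.le⟩).1.le)
      0 (left_mem_Icc.2 hεpos.le) s hs hs.1
    simp only [sub_zero, hθ0, hg1 x hx] at key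
    linarith
  -- hence `g > 1` at the points of `O` with `0 < F ≤ ε`
  have hg_out : ∀ z ∈ O, 0 < F z → F z ≤ ε → 1 < g z := by
    intro z hz hFz hFzε
    have hs : -F z ∈ Icc (-(4 * η₀)) (4 * η₀) := ⟨by linarith, by linarith⟩
    set x := θ z (-F z) with hx
    have hFx : F x = 0 := by rw [hx, hclock z hz _ hs]; ring
    have hzx : θ x (F z) = z := by rw [hx, ← hadd, neg_add_cancel, hθ0]
    have h := hout x hFx (F z) ⟨hFz.le, hFzε⟩
    rw [hzx] at h
    nlinarith
  -- the cut-off: a plateau for `D` inside the open set `W = {F < 0} ∪ (O ∩ {F < ε})`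
  set W : Set E := {z | F z < 0} ∪ (O ∩ {z | F z < ε}) with hW
  have hWo : IsOpen W := (isOpen_lt hF.continuous continuous_const).union
    (hOo.inter (isOpen_lt hF.continuous continuous_const))
  have hDW : {x : E | F x ≤ 0} ⊆ W := fun z hz => by
    rcases (show F z ≤ 0 from hz).lt_or_eq with h | h
    · exact Or.inl h
    · exact Or.inr ⟨hZO h, by show F z < ε; rw [h]; exact hεpos⟩
  obtain ⟨δ, ρ, hδ, hsubW, hρc, hρ01, hρ1, hρcs, hρsupp⟩ :=
    exists_contDiff_plateau_cthickening hD hWo hDW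
  -- the modified clock
  set ĝ : E → ℝ := fun z => 2 + ρ z * (g z - 2) with hĝ
  have hĝc : ContDiff ℝ ∞ ĝ := contDiff_const.add (hρc.mul (hg.sub contDiff_const))
  -- `ĝ = g` on the open `δ`-thickening of `D`
  have hĝU : ∀ z ∈ thickening δ {x : E | F x ≤ 0}, ĝ z = g z := fun z hz => by
    have h1 : ρ z = 1 := hρ1 z (thickening_subset_cthickening δ _ hz)
    simp only [hĝ, h1]; ring
  -- key: `ĝ z ≤ 1 → F z ≤ 0`
  have hkey : ∀ z, ĝ z ≤ 1 → F z ≤ 0 := by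
    intro z hz
    by_contra hFz
    rw [not_le] at hFz
    have hρz : ρ z ≠ 0 := by
      intro h0
      have : ĝ z = 2 := by simp only [hĝ, h0]; ring
      linarith
    have hzW : z ∈ W := hsubW (hρsupp (subset_tsupport _ hρz))
    rcases hzW with h | ⟨hzO, hzε⟩
    · exact absurd h (not_lt.2 hFz.le)
    · have hg1z : 1 < g z := hg_out z hzO hFz (le_of_lt hzε)
      have hρle : ρ z ≤ 1 := (hρ01 z).2
      have hρnn : 0 ≤ ρ z := (hρ01 z).1
      -- `ĝ z = 2 + ρ (g - 2) ≥ min (2, g z) > 1`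
      have : 1 < ĝ z := by
        show 1 < 2 + ρ z * (g z - 2)
        rcases le_or_gt (g z) 2 with hg2 | hg2
        · nlinarith
        · nlinarith
      linarith
  have hDth : {x : E | F x ≤ 0} ⊆ thickening δ {x : E | F x ≤ 0} := self_subset_thickening hδ _
  refine ⟨ĝ, hĝc, ⟨thickening δ {x | F x ≤ 0}, isOpen_thickening, hDth, hĝU⟩,
    ⟨tsupport ρ, hρcs, fun z hz => ?_⟩, fun z => ⟨hkey z, fun hz => ?_⟩,
    fun z => ⟨fun hz => ?_, fun hz => ?_⟩, fun s hs => ?_⟩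
  · -- `ĝ = 2` off the support of `ρ`
    have h0 : ρ z = 0 := image_eq_zero_of_notMem_tsupport hz
    simp only [hĝ, h0]; ring
  · -- `F z ≤ 0 → ĝ z ≤ 1`
    rw [hĝU z (hDth hz)]
    exact hgle z hz
  · -- `ĝ z = 1 → F z = 0`
    have hF0 : F z ≤ 0 := hkey z hz.le
    rcases hF0.lt_or_eq with h | h
    · have := hglt z h
      rw [hĝU z (hDth hF0)] at hz
      linarith
    · exact h
  · -- `F z = 0 → ĝ z = 1`
    rw [hĝU z (hDth (le_of_eq hz))]
    exact hg1 z hz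
  · -- compact sublevel sets below `2`
    refine hρcs.of_isClosed_subset (isClosed_le hĝc.continuous continuous_const) fun z hz => ?_
    by_contra h
    have h0 : ρ z = 0 := image_eq_zero_of_notMem_tsupport h
    have : ĝ z = 2 := by simp only [hĝ, h0]; ring
    exact absurd (show ĝ z ≤ s from hz) (by rw [this]; exact not_le.2 hs)

end Literature.Geometry.Riemannian

end
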